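import Summits.QuantumFields.YangMills.Theorems.BalabanUVNodesN16UniformScalarAverage
import HarnessLib

/-!
# Balaban UV nodes, N16 width lane (N07 → N16 in-edge), file 22c: THE BLOCK-PARABOLA PROFILE AND THE GRADED SHEET FIELD — the average (42) EXACTLY
# (scalar sector, every `L`; part 1 of the L-UNIFORM existence of run-1 minimisers at the sheet datum, completed in file 22d)

Explicit-unit helper of lineage `pub-ymgap-dag-n16-w1` (generation 8), cell `pub-ymgap`, keyed to K3⁸ `stmt-QuantumFields-27366`
(`SpineGivenEndpointR13SepCoPHV`, skeleton v6 b4e55110ab73e679).  `--kind proof --supports stmt-QuantumFields-27366 --as helper`.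
COUNT-NEUTRAL: no statement item is closed, no stub of the v6 skeleton (`stub_rates13HV`, `stub_expansion13HV`) is named or discharged, node N07
and node N16 are NOT discharged here.

WHY.  File 22b's floor `c ≥ 1∕(4d+9)` for the gradient letter of the lineage's sup key needs a run-1 minimiser at the sheet datum of file 22a, got there
from dag-n16-w2's existence at the INFLATED class radius `ε₁L²` (slice pullback), whence the hypothesis `L² ≤ C.B₃`.  This file and 22d replace the
slice pullback by an EXPLICIT SMOOTH PREIMAGE of the sheet datum in the scalar (centre-valued) sector, of class radius `6φ·L∕(L+1) < 6φ` for a sheet of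
amplitude `φ` — k-, L- and N-uniform — so that 22d's floor holds under `6 ≤ C.B₃`.  TOOLS BY NAME: pub-balaban's scalar calculus of (9)∕(42)∕(44)
(`T4AveragingDeficitWallBoundary` §1: `scalarCfg`, `hol_scalarCfg`, `Xi`, `bavg_scalarCfg`) and dag-n16-w2 g6's block sums (`…N16UniformScalarAverage.sum_pi_fin`,
`sum_coord_eq_complex`, p628184) — the template of dag-n16-w2's Landau-family computation, here for a field graded by an ARBITRARY profile of one coordinate.

## What is proved (sorry-free, classical axioms only, THEOREMS ONLY — 0 `def`)

* §1 `six_mul_sum_parabola` ∕ `sum_fin_parabola`: `Σ_{s<L} s(L − s) = (L³ − L)∕6`.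
* §2 THE BLOCK-PARABOLA PROFILE `a : ℤ → ℝ` through its equations (`hc`: `a(t) = h·s(L−s)`, `s = t mod L`, on CHARGED blocks `N ∣ ⌊t∕L⌋`; `hu`: `a(t) = 0`
  on uncharged blocks; `exists_profile`): `profile_block_start` (`a(Lz) = 0`), `profile_block`, ★ `profile_block_sum` (`Σ_{s<L} a(Lz+s) = h(L³−L)∕6` on a
  charged block, `0` else), `profile_bounds` (`0 ≤ a ≤ hL²`), ★ `profile_increment` (`|a(t+1) − a(t)| ≤ h(L−1)`), `profile_periodic` (period `N·L`).
* §3 THE GRADED SHEET FIELD `F(x, e₁) = i·a(x₀)`, `F(x, e_κ) = 0` (`κ ≠ 1`) (hypothesis `hF`): `asum_(replicate∕seg∕flatMap_seg∕treeWord)_graded` (the tree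
  contour runs its `e₁`-segment at the ORIGINAL `0`-th coordinate), ★ `phi_graded` (the loop exponents of (42): `i·r₁(a(q₀) − a(q₀+L))` on `e₀`-bonds,
  `i·L(a(q₀+r₀) − a(q₀))` on `e₁`-bonds, `0` else), `phi_graded_small` (log branch from `|a| ≤ M`, `2LM < ln 2`), ★ `Xi_graded` (the exponent of (42):
  first moment `(L−1)∕2` on `e₀`, BLOCK SUM `Σ_{s<L}a(q₀+s) − La(q₀)` on `e₁`), ★★ `bavg_graded` ((42) EXACTLY: `V̄(q,e₁) = e^{iΣ_{s<L}a(q₀+s)}·1`,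
  `V̄(q,e₀) = e^{i(a(q₀)−a(q₀+L))(L−1)∕2}·1`, `V̄(q,e_μ) = 1` for `μ ≥ 2`).

HONEST FRAMING.  Exact kinematics of explicit centre-valued configurations; nothing of Bałaban asserted or refuted; the sup key NOT touched here; no stub of
K3⁸ v6 named or closed; N16 ∕ N07 NOT discharged; counts of record unmoved (typed 28∕28 · discharged 5∕28); one finite four-torus at fixed `ε` — NOT ℝ⁴,
NOT infinite volume, NOT OS, NOT a mass gap; the YM mass gap (Clay) is NOT proved by any of this — R4 closes the conditional finite-𝕋⁴ rung `BalabanLadder.UV` only.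

Sources: [Balaban1985Averaging] (9), (42)–(44) pp. 18–24; [Balaban1984PropagatorsI] (1.7) p. 18 (the tree contour).
-/
set_option autoImplicit false

open scoped BigOperators Matrix Matrix.Norms.L2Operator
open NormedSpace Finset

namespace Summit.QuantumFields.YangMills.BalabanUVNodes.N16SheetDatumPreimage

open Literature.MathematicalPhysics.QuantumFieldTheory.Balaban1983to89
open B7Prop1Explicit B7Prop2Explicit MatrixLog UnitaryModel
open T4AveragingDeficitWall hiding Site Plane Plaq Bond
open T4AveragingDeficitWallBoundary (IsPeriodicCfg scalarCfg hol_scalarCfg val_hol_scalarCfg Xi bavg_scalarCfg add_e_apply_zero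
  add_zsmul_e_apply_zero add_e_zero_apply_zero add_zsmul_e_zero_apply_zero fin_one_ne_zero fin_zero_ne_one norm_real_mul_I)
open FederbushMean (cexp_smul_one)
open Summit.QuantumFields.BalabanUV.T4Continuum
open Summit.QuantumFields.YangMills.BalabanUVNodes.N16UniformScalarAverage (sum_pi_fin sum_coord_eq_complex)

noncomputable section

variable {d : ℕ} {n : Type} [Fintype n] [DecidableEq n]

/-! ## §1 The block parabola: `Σ_{s<L} s(L − s) = (L³ − L)∕6` -/
/-- `6·Σ_{s<L} s(L−s) = L³ − L` (over `ℝ`). [folklore] -/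
theorem six_mul_sum_parabola (L : ℕ) :
    6 * ∑ s ∈ Finset.range L, ((s : ℝ) * ((L : ℝ) - s)) = (L : ℝ) ^ 3 - L := by
  induction L with
  | zero => simp
  | succ L ih =>
    have hsplit : ∑ s ∈ Finset.range (L + 1), ((s : ℝ) * (((L + 1 : ℕ) : ℝ) - s))
        = ∑ s ∈ Finset.range (L + 1), ((s : ℝ) * ((L : ℝ) - s)) + ∑ s ∈ Finset.range (L + 1), (s : ℝ) := by
      rw [← Finset.sum_add_distrib]
      refine Finset.sum_congr rfl fun s _ => ?_
      push_cast; ring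
    have hlast : ∑ s ∈ Finset.range (L + 1), ((s : ℝ) * ((L : ℝ) - s)) = ∑ s ∈ Finset.range L, ((s : ℝ) * ((L : ℝ) - s)) := by
      rw [Finset.sum_range_succ]; simp
    have hgauss : ∑ s ∈ Finset.range (L + 1), (s : ℝ) = (L : ℝ) * (L + 1) / 2 := by
      have h := Finset.sum_range_id_mul_two (L + 1)
      rw [add_tsub_cancel_right] at h
      have h2 : (((∑ s ∈ Finset.range (L + 1), s : ℕ) : ℝ)) * 2 = (((L + 1) * L : ℕ) : ℝ) := by exact_mod_cast h
      push_cast at h2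
      linarith
    rw [hsplit, hlast, mul_add, ih, hgauss]
    push_cast; ring

/-- The same over `Fin L`. [folklore] -/
theorem sum_fin_parabola (L : ℕ) :
    ∑ s : Fin L, ((s : ℕ) : ℝ) * ((L : ℝ) - ((s : ℕ) : ℝ)) = ((L : ℝ) ^ 3 - L) / 6 := by
  have h := six_mul_sum_parabola L
  rw [Fin.sum_univ_eq_sum_range (fun s => (s : ℝ) * ((L : ℝ) - s)) L] 
  linarith

/-! ## §2 The block-parabola profile, through its defining equations -/

section Profile

/-! THE PROFILE EQUATIONS for `(L, N, h)`: `a(t) = h·s(L − s)`, `s = t mod L`, on CHARGED blocks (`N ∣ ⌊t∕L⌋`), `a(t) = 0` otherwise —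
hypotheses `hc` ∕ `hu`; `exists_profile` solves them. -/
variable {L N : ℕ} {h : ℝ} {a : ℤ → ℝ}

/-- The profile equations have a solution. [folklore] -/
theorem exists_profile (L N : ℕ) (h : ℝ) : ∃ a : ℤ → ℝ,
    (∀ t : ℤ, (N : ℤ) ∣ t / L → a t = h * ((t % L : ℤ) : ℝ) * ((L : ℝ) - ((t % L : ℤ) : ℝ))) ∧
    (∀ t : ℤ, ¬ (N : ℤ) ∣ t / L → a t = 0) :=
  ⟨fun t => if (N : ℤ) ∣ t / L then h * ((t % L : ℤ) : ℝ) * ((L : ℝ) - ((t % L : ℤ) : ℝ)) else 0,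
    fun t ht => by simp [ht], fun t ht => by simp [ht]⟩

variable (hL : 1 ≤ L)
  (hc : ∀ t : ℤ, (N : ℤ) ∣ t / L → a t = h * ((t % L : ℤ) : ℝ) * ((L : ℝ) - ((t % L : ℤ) : ℝ)))
  (hu : ∀ t : ℤ, ¬ (N : ℤ) ∣ t / L → a t = 0)
include hL hc hu

/-- The profile vanishes at every block start `t = L·z`. [folklore] -/
theorem profile_block_start (z : ℤ) : a ((L : ℤ) * z) = 0 := by
  have hL0 : (L : ℤ) ≠ 0 := by exact_mod_cast (show L ≠ 0 by omega)
  by_cases hz : (N : ℤ) ∣ ((L : ℤ) * z) / L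
  · rw [hc _ hz, Int.mul_emod_right]; simp
  · exact hu _ hz

/-- Inside the block of `z`: `a(Lz + s) = h·s(L−s)` on a charged block, `0` on an uncharged one (`0 ≤ s < L`). [folklore] -/
theorem profile_block (z : ℤ) {s : ℤ} (hs0 : 0 ≤ s) (hsL : s < L) :
    a ((L : ℤ) * z + s) = if (N : ℤ) ∣ z then h * (s : ℝ) * ((L : ℝ) - (s : ℝ)) else 0 := by
  have hL0 : (0 : ℤ) < L := by exact_mod_cast (show 0 < L by omega)
  have hdiv : ((L : ℤ) * z + s) / L = z := by
    rw [add_comm, Int.add_mul_ediv_left _ _ hL0.ne', Int.ediv_eq_zero_of_lt hs0 hsL, zero_add]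
  have hmod : ((L : ℤ) * z + s) % L = s := by
    rw [add_comm, Int.add_mul_emod_self_left, Int.emod_eq_of_lt hs0 hsL]
  by_cases hz : (N : ℤ) ∣ z
  · rw [if_pos hz, hc _ (by rwa [hdiv]), hmod]
  · rw [if_neg hz, hu _ (by rwa [hdiv])]

/-- **THE BLOCK SUMS**: `Σ_{s<L} a(Lz + s) = h·(L³ − L)∕6` on a charged block, `0` on an uncharged one. [folklore] -/
theorem profile_block_sum (z : ℤ) :
    ∑ s : Fin L, a ((L : ℤ) * z + ((s : ℕ) : ℤ)) = if (N : ℤ) ∣ z then h * (((L : ℝ) ^ 3 - L) / 6) else 0 := by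
  have key : ∀ s : Fin L, a ((L : ℤ) * z + ((s : ℕ) : ℤ))
      = if (N : ℤ) ∣ z then h * (((s : ℕ) : ℝ) * ((L : ℝ) - ((s : ℕ) : ℝ))) else 0 := by
    intro s
    rw [profile_block hL hc hu z (by positivity) (by exact_mod_cast s.isLt)]
    split_ifs
    · push_cast; ring
    · rfl
  simp_rw [key]
  split_ifs
  · rw [← Finset.mul_sum, sum_fin_parabola]
  · simp

/-- The profile is `0 ≤ a ≤ h·L²` (for `h ≥ 0`). [folklore] -/
theorem profile_bounds (hh : 0 ≤ h) (t : ℤ) : 0 ≤ a t ∧ a t ≤ h * (L : ℝ) ^ 2 := by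
  have hL0 : (0 : ℤ) < L := by exact_mod_cast (show 0 < L by omega)
  by_cases ht : (N : ℤ) ∣ t / L
  · rw [hc _ ht]
    have h0 : (0 : ℝ) ≤ ((t % L : ℤ) : ℝ) := by exact_mod_cast Int.emod_nonneg _ hL0.ne'
    have h1 : ((t % L : ℤ) : ℝ) ≤ (L : ℝ) := by
      have := Int.emod_lt_of_pos t hL0
      have : ((t % L : ℤ) : ℝ) < ((L : ℤ) : ℝ) := by exact_mod_cast this
      push_cast at this; linarith
    have h2 : 0 ≤ (L : ℝ) - ((t % L : ℤ) : ℝ) := by linarith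
    constructor
    · positivity
    · have h3 : ((t % L : ℤ) : ℝ) * ((L : ℝ) - ((t % L : ℤ) : ℝ)) ≤ (L : ℝ) ^ 2 := by nlinarith
      calc h * ((t % L : ℤ) : ℝ) * ((L : ℝ) - ((t % L : ℤ) : ℝ)) = h * (((t % L : ℤ) : ℝ) * ((L : ℝ) - ((t % L : ℤ) : ℝ))) := by ring
        _ ≤ h * (L : ℝ) ^ 2 := mul_le_mul_of_nonneg_left h3 hh
  · rw [hu _ ht]; constructor
    · exact le_rfl
    · positivity

/-- **THE INCREMENTS**: `|a(t+1) − a(t)| ≤ h·(L − 1)` for `h ≥ 0` (inside a charged block the increment is `h(L − 1 − 2s)`; across a block boundary the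
profile returns to `0` from `h(L−1)·1` or from `0`). [folklore] -/
theorem profile_increment (hh : 0 ≤ h) (t : ℤ) : |a (t + 1) - a t| ≤ h * ((L : ℝ) - 1) := by
  have hL0 : (0 : ℤ) < L := by exact_mod_cast (show 0 < L by omega)
  have hL1 : (1 : ℝ) ≤ L := by exact_mod_cast hL
  -- write `t = L z + s`
  set z : ℤ := t / L with hzdef
  set s : ℤ := t % L with hsdef
  have hts : t = (L : ℤ) * z + s := (Int.mul_ediv_add_emod t L).symm
  have hs0 : 0 ≤ s := Int.emod_nonneg _ hL0.ne'
  have hsL : s < L := Int.emod_lt_of_pos t hL0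
  have hat : a t = if (N : ℤ) ∣ z then h * (s : ℝ) * ((L : ℝ) - (s : ℝ)) else 0 := by
    rw [hts]; exact profile_block hL hc hu z hs0 hsL
  by_cases hb : s + 1 < L
  · -- same block
    have hat1 : a (t + 1) = if (N : ℤ) ∣ z then h * ((s + 1 : ℤ) : ℝ) * ((L : ℝ) - ((s + 1 : ℤ) : ℝ)) else 0 := by
      rw [hts, add_assoc]; exact profile_block hL hc hu z (by omega) hb
    rw [hat, hat1]
    split_ifs
    · have hsR0 : (0 : ℝ) ≤ (s : ℝ) := by exact_mod_cast hs0
      have hsR1 : (s : ℝ) + 1 < (L : ℝ) := by exact_mod_cast hb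
      rw [show h * ((s + 1 : ℤ) : ℝ) * ((L : ℝ) - ((s + 1 : ℤ) : ℝ)) - h * (s : ℝ) * ((L : ℝ) - (s : ℝ))
        = h * ((L : ℝ) - 1 - 2 * (s : ℝ)) by push_cast; ring, abs_mul, abs_of_nonneg hh]
      refine mul_le_mul_of_nonneg_left (abs_le.mpr ⟨by linarith, by linarith⟩) hh
    · simp only [sub_self, abs_zero]; exact mul_nonneg hh (by linarith)
  · -- block boundary: `s = L − 1`, `t + 1 = L (z + 1)`
    have hs : s = L - 1 := by omega
    have hat1 : a (t + 1) = 0 := by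
      rw [hts, hs, show (L : ℤ) * z + ((L : ℤ) - 1) + 1 = (L : ℤ) * (z + 1) by ring]
      exact profile_block_start hL hc hu (z + 1)
    rw [hat1, hat, zero_sub, abs_neg]
    split_ifs
    · rw [hs]; push_cast
      rw [show h * ((L : ℝ) - 1) * ((L : ℝ) - ((L : ℝ) - 1)) = h * ((L : ℝ) - 1) by ring, abs_of_nonneg (mul_nonneg hh (by linarith))]
    · rw [abs_zero]; exact mul_nonneg hh (by linarith)

/-- The profile is `(N·L)`-periodic. [folklore] -/
theorem profile_periodic (t : ℤ) : a (t + (N : ℤ) * L) = a t := by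
  have hL0 : (0 : ℤ) < L := by exact_mod_cast (show 0 < L by omega)
  have hdiv : (t + (N : ℤ) * L) / L = t / L + N := Int.add_mul_ediv_right _ _ hL0.ne'
  have hmod : (t + (N : ℤ) * L) % L = t % L := Int.add_mul_emod_self_right _ _ _
  have hiff : ((N : ℤ) ∣ (t + (N : ℤ) * L) / L) ↔ ((N : ℤ) ∣ t / L) := by
    rw [hdiv]; exact (dvd_add_left (dvd_refl _)) |>.symm |>.symm
  by_cases ht : (N : ℤ) ∣ t / L
  · rw [hc _ (hiff.mpr ht), hc _ ht, hmod]
  · rw [hu _ (fun h' => ht (hiff.mp h')), hu _ ht]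

end Profile

/-! ## §3 The graded sheet field `F(x, e₁) = i·a(x₀)`, `F(x, e_κ) = 0` (`κ ≠ 1`): path sums, the loop exponents and the average (42) -/

section PathSums

variable {F : B7Prop1Explicit.Site (d + 2) → Fin (d + 2) → ℂ} {a : ℤ → ℝ}
  (hF : ∀ (x : B7Prop1Explicit.Site (d + 2)) (κ : Fin (d + 2)), F x κ = if κ = 1 then ((a (x 0) : ℝ) : ℂ) * Complex.I else 0)
include hF

/-- `A` along `m` forward steps in direction `κ` from `p`: `m·i·a(p₀)` for `κ = e₁` (the `0`-th coordinate does not move), `0` otherwise. [folklore] -/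
theorem asum_replicate_graded (κ : Fin (d + 2)) (m : ℕ) : ∀ p : B7Prop1Explicit.Site (d + 2),
    asum F p (List.replicate m ((κ, true) : Letter (d + 2)))
      = if κ = 1 then (m : ℂ) * (((a (p 0) : ℝ) : ℂ) * Complex.I) else 0 := by
  induction m with
  | zero => intro p; simp
  | succ m ih =>
    intro p
    rw [List.replicate_succ, asum_cons, ih, stepA_true, hF]
    by_cases hκ1 : κ = 1
    · subst hκ1
      rw [if_pos rfl, if_pos rfl, if_pos rfl]
      have : (p + Letter.vec (((1 : Fin (d + 2)), true) : Letter (d + 2))) 0 = p 0 := by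
        simp [e_apply]
      rw [this]; push_cast; ring
    · rw [if_neg hκ1, if_neg hκ1, if_neg hκ1, add_zero]

/-- `A([p, p + m e_κ])`. [folklore] -/
theorem asum_seg_graded (κ : Fin (d + 2)) (m : ℕ) (p : B7Prop1Explicit.Site (d + 2)) :
    asum F p (seg κ (m : ℤ)) = if κ = 1 then (m : ℂ) * (((a (p 0) : ℝ) : ℂ) * Complex.I) else 0 := by
  rw [seg_natCast, asum_replicate_graded hF]

/-- The tree part: along a duplicate-free list of directions avoiding `e₀`, only the `e₁`-segment contributes, and it sees the ORIGINAL `0`-th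
coordinate. [folklore] -/
theorem asum_flatMap_seg_graded (L : ℕ) (r : Fin (d + 2) → Fin L) :
    ∀ (l : List (Fin (d + 2))) (q : B7Prop1Explicit.Site (d + 2)), (0 : Fin (d + 2)) ∉ l → l.Nodup →
      asum F q (l.flatMap fun κ => seg κ (boxVec L r κ))
        = if (1 : Fin (d + 2)) ∈ l then ((r 1 : ℕ) : ℂ) * (((a (q 0) : ℝ) : ℂ) * Complex.I) else 0 := by
  intro l
  induction l with
  | nil => intro q _ _; simp
  | cons κ l ih =>
    intro q h0 hnd
    have hκ0 : κ ≠ 0 := fun h => h0 (h ▸ List.mem_cons_self)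
    have h0l : (0 : Fin (d + 2)) ∉ l := fun h => h0 (List.mem_cons_of_mem _ h)
    have hndl : l.Nodup := (List.nodup_cons.mp hnd).2
    have hκl : κ ∉ l := (List.nodup_cons.mp hnd).1
    rw [List.flatMap_cons, asum_append, ih _ h0l hndl]
    have hbv : boxVec L r κ = ((r κ : ℕ) : ℤ) := rfl
    rw [hbv, asum_seg_graded hF, seg_natCast, disp_replicate]
    have hq : (q + ((r κ : ℕ) : ℤ) • Letter.vec (((κ, true)) : Letter (d + 2))) 0 = q 0 := by
      simp [e_apply, Ne.symm hκ0]
    rw [hq]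
    by_cases hκ1 : κ = 1
    · subst hκ1
      rw [if_pos rfl, if_neg hκl, if_pos List.mem_cons_self, add_zero]
    · rw [if_neg hκ1, zero_add]
      have : ((1 : Fin (d + 2)) ∈ κ :: l) ↔ (1 : Fin (d + 2)) ∈ l := by
        rw [List.mem_cons]; exact ⟨fun h => h.resolve_left (fun h1 => hκ1 h1.symm), Or.inr⟩
      simp only [this]

/-- `A(Γ^{tree}_{q, q + r}) = r₁·i·a(q₀)` for `r ∈ [0,L)^{d+2}` (the tree contour changes the coordinates in the order `d+1, …, 1, 0`, so the
`e₁`-segment runs at the original `0`-th coordinate; the `e₀`-segment carries no exponent). [folklore] -/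
theorem asum_treeWord_graded (L : ℕ) (q : B7Prop1Explicit.Site (d + 2)) (r : Fin (d + 2) → Fin L) :
    asum F q (treeWord (boxVec L r)) = ((r 1 : ℕ) : ℂ) * (((a (q 0) : ℝ) : ℂ) * Complex.I) := by
  rw [treeWord, List.finRange_succ, List.reverse_cons, List.flatMap_append, asum_append, List.flatMap_cons, List.flatMap_nil,
    List.append_nil]
  have hbv : boxVec L r 0 = ((r 0 : ℕ) : ℤ) := rfl
  rw [hbv, asum_seg_graded hF, if_neg fin_zero_ne_one, add_zero]
  have h0 : (0 : Fin (d + 2)) ∉ ((List.finRange (d + 1)).map Fin.succ).reverse := by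
    rw [List.mem_reverse, List.mem_map]
    rintro ⟨j, _, hj⟩
    exact Fin.succ_ne_zero j hj
  have hnd : (((List.finRange (d + 1)).map Fin.succ).reverse).Nodup :=
    List.nodup_reverse.mpr ((List.nodup_finRange _).map (Fin.succ_injective _))
  have h1 : (1 : Fin (d + 2)) ∈ ((List.finRange (d + 1)).map Fin.succ).reverse := by
    rw [List.mem_reverse, List.mem_map]
    exact ⟨0, List.mem_finRange 0, rfl⟩
  rw [asum_flatMap_seg_graded hF L r _ q h0 hnd, if_pos h1]

/-- **★ THE LOOP EXPONENTS OF (42) ON THE GRADED SHEET FIELD**: `A(Γ_{c,x_r}) − A(c) = i·r₁·(a(q₀) − a(q₀ + L))` on `e₀`-bonds (the two tree contours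
run their `e₁`-segments at `0`-th coordinates `q₀` and `q₀ + L`), `= i·L·(a(q₀ + r₀) − a(q₀))` on `e₁`-bonds (the straight segments at `q₀ + r₀` and `q₀`),
`0` on all other bonds. [cite: Balaban1985Averaging, (42) p.23] -/
theorem phi_graded (L : ℕ) (q : B7Prop1Explicit.Site (d + 2)) (κ : Fin (d + 2)) (r : Fin (d + 2) → Fin L) :
    asum F q (gammaWord L κ (boxVec L r)) - asum F q (seg κ (L : ℤ))
      = ((if κ = 0 then ((r 1 : ℕ) : ℝ) * (a (q 0) - a (q 0 + L))
          else if κ = 1 then (L : ℝ) * (a (q 0 + ((r 0 : ℕ) : ℤ)) - a (q 0)) else 0 : ℝ) : ℂ) * Complex.I := by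
  rw [asum_gammaWord, asum_treeWord_graded hF, asum_treeWord_graded hF, asum_seg_graded hF κ L (q + boxVec L r),
    asum_seg_graded hF κ L q]
  have hq : (q + boxVec L r) 0 = q 0 + ((r 0 : ℕ) : ℤ) := by simp [boxVec]
  by_cases hκ0 : κ = 0
  · subst hκ0
    have hq0 : (q + (L : ℤ) • e (0 : Fin (d + 2))) 0 = q 0 + L := add_zsmul_e_zero_apply_zero q L
    simp only [fin_zero_ne_one, if_false, if_true, hq0]
    push_cast; ring
  · by_cases hκ1 : κ = 1
    · subst hκ1
      simp only [fin_one_ne_zero, if_false, if_true, hq, add_zsmul_e_apply_zero fin_one_ne_zero]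
      push_cast; ring
    · simp only [hκ0, hκ1, if_false, add_zsmul_e_apply_zero hκ0]
      push_cast; ring

/-- All loop exponents lie inside the log branch as soon as `|a| ≤ M` with `2·L·M < ln 2`. [folklore] -/
theorem phi_graded_small (L : ℕ) {M : ℝ} (hM : ∀ t, |a t| ≤ M) (hLM : 2 * (L : ℝ) * M < Real.log 2)
    (q : B7Prop1Explicit.Site (d + 2)) (κ : Fin (d + 2)) (r : Fin (d + 2) → Fin L) :
    ‖asum F q (gammaWord L κ (boxVec L r)) - asum F q (seg κ (L : ℤ))‖ < Real.log 2 := by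
  rw [phi_graded hF, norm_real_mul_I]
  have hr : ∀ m : Fin (d + 2), ((r m : ℕ) : ℝ) ≤ (L : ℝ) := fun m => by exact_mod_cast (r m).isLt.le
  have hr0 : ∀ m : Fin (d + 2), (0 : ℝ) ≤ ((r m : ℕ) : ℝ) := fun m => by positivity
  have hM0 : 0 ≤ M := (abs_nonneg _).trans (hM 0)
  have hdiff : ∀ t t' : ℤ, |a t - a t'| ≤ 2 * M := fun t t' =>
    (abs_sub _ _).trans (by linarith [hM t, hM t'])
  refine lt_of_le_of_lt ?_ hLM
  split_ifs
  · rw [abs_mul, abs_of_nonneg (hr0 1)]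
    calc ((r 1 : ℕ) : ℝ) * |a (q 0) - a (q 0 + L)| ≤ (L : ℝ) * (2 * M) :=
          mul_le_mul (hr 1) (hdiff _ _) (abs_nonneg _) (by positivity)
      _ = 2 * (L : ℝ) * M := by ring
  · rw [abs_mul, abs_of_nonneg (by positivity : (0 : ℝ) ≤ L)]
    calc (L : ℝ) * |a (q 0 + ((r 0 : ℕ) : ℤ)) - a (q 0)| ≤ (L : ℝ) * (2 * M) :=
          mul_le_mul_of_nonneg_left (hdiff _ _) (by positivity)
      _ = 2 * (L : ℝ) * M := by ring
  · rw [abs_zero]; positivity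

/-- **★ THE EXPONENT OF (42) ON THE GRADED SHEET FIELD**: `Ξ(q, e₀) = i·(a(q₀) − a(q₀ + L))·(L−1)∕2` (the block's first moment),
`Ξ(q, e₁) = i·(Σ_{s<L} a(q₀ + s) − L·a(q₀))` (the block sum of the profile), `Ξ(q, e_μ) = 0` (`μ ≥ 2`). [cite: Balaban1985Averaging, (42) p.23] -/
theorem Xi_graded (L : ℕ) (hL : 1 ≤ L) (q : B7Prop1Explicit.Site (d + 2)) (κ : Fin (d + 2)) :
    Xi L F q κ = ((if κ = 0 then (a (q 0) - a (q 0 + L)) * ((L : ℝ) - 1) / 2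
        else if κ = 1 then (∑ s : Fin L, a (q 0 + ((s : ℕ) : ℤ))) - (L : ℝ) * a (q 0) else 0 : ℝ) : ℂ) * Complex.I := by
  have hL0 : (L : ℂ) ≠ 0 := by exact_mod_cast (show L ≠ 0 by omega)
  have hLd : (L : ℂ) ^ (d + 2) ≠ 0 := pow_ne_zero _ hL0
  unfold Xi
  simp_rw [phi_graded hF]
  by_cases hκ0 : κ = 0
  · simp_rw [if_pos hκ0]
    have : ∀ r : Fin (d + 2) → Fin L, ((L : ℂ) ^ (d + 2))⁻¹ * (((((r 1 : ℕ) : ℝ) * (a (q 0) - a (q 0 + L)) : ℝ) : ℂ) * Complex.I)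
        = ((r 1 : ℕ) : ℂ) * (((L : ℂ) ^ (d + 2))⁻¹ * (((a (q 0) - a (q 0 + L) : ℝ) : ℂ)) * Complex.I) := by
      intro r; push_cast; ring
    rw [Finset.sum_congr rfl fun r _ => this r, ← Finset.sum_mul, sum_coord_eq_complex]
    push_cast
    field_simp
  · simp_rw [if_neg hκ0]
    by_cases hκ1 : κ = 1
    · simp_rw [if_pos hκ1]
      have hrw : ∀ r : Fin (d + 2) → Fin L,
          ((L : ℂ) ^ (d + 2))⁻¹ * (((((L : ℝ) * (a (q 0 + ((r 0 : ℕ) : ℤ)) - a (q 0))) : ℝ) : ℂ) * Complex.I)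
            = (fun j : Fin L => (((L : ℂ) ^ (d + 2))⁻¹ * (L : ℂ)) * (((a (q 0 + ((j : ℕ) : ℤ)) - a (q 0) : ℝ) : ℂ) * Complex.I)) (r 0) := by
        intro r; push_cast; ring
      rw [Finset.sum_congr rfl fun r _ => hrw r, sum_pi_fin L 0 (fun j : Fin L => (((L : ℂ) ^ (d + 2))⁻¹ * (L : ℂ)) * (((a (q 0 + ((j : ℕ) : ℤ)) - a (q 0) : ℝ) : ℂ) * Complex.I)), ← Finset.mul_sum, ← Finset.sum_mul]
      have hxs : (∑ j : Fin L, ((a (q 0 + ((j : ℕ) : ℤ)) - a (q 0) : ℝ) : ℂ))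
          = (((∑ s : Fin L, a (q 0 + ((s : ℕ) : ℤ))) : ℝ) : ℂ) - (L : ℂ) * ((a (q 0) : ℝ) : ℂ) := by
        push_cast
        rw [Finset.sum_sub_distrib]
        simp only [Finset.sum_const, Finset.card_univ, Fintype.card_fin, nsmul_eq_mul]
      rw [hxs]
      push_cast
      field_simp
      ring
    · simp_rw [if_neg hκ1]
      simp

/-- **★ (42) EVALUATED ON THE GRADED SHEET FIELD** (`L ≥ 1`, log branch `|a| ≤ M`, `2LM < ln 2`): `V̄(q, e₁) = e^{i·Σ_{s<L} a(q₀+s)}·1` (the BLOCK SUM of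
the profile), `V̄(q, e₀) = e^{i(a(q₀) − a(q₀+L))(L−1)∕2}·1`, `V̄(q, e_μ) = 1` (`μ ≥ 2`). [cite: Balaban1985Averaging, (42) p.23] -/
theorem bavg_graded [Nonempty n] (L : ℕ) (hL : 1 ≤ L) {M : ℝ} (hM : ∀ t, |a t| ≤ M) (hLM : 2 * (L : ℝ) * M < Real.log 2)
    (q : B7Prop1Explicit.Site (d + 2)) (κ : Fin (d + 2)) :
    bavg L (scalarCfg (n := n) F) q κ
      = expUnit (((((if κ = 0 then (a (q 0) - a (q 0 + L)) * ((L : ℝ) - 1) / 2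
          else if κ = 1 then ∑ s : Fin L, a (q 0 + ((s : ℕ) : ℤ)) else 0 : ℝ) : ℂ) * Complex.I)) • (1 : Matrix n n ℂ)) := by
  rw [bavg_scalarCfg L F q κ (phi_graded_small hF L hM hLM q κ)]
  have key : Xi L F q κ + asum F q (seg κ (L : ℤ))
      = (((if κ = 0 then (a (q 0) - a (q 0 + L)) * ((L : ℝ) - 1) / 2
          else if κ = 1 then ∑ s : Fin L, a (q 0 + ((s : ℕ) : ℤ)) else 0 : ℝ) : ℂ) * Complex.I) := by
    rw [Xi_graded hF L hL, asum_seg_graded hF κ L q]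
    by_cases hκ0 : κ = 0
    · subst hκ0
      simp only [fin_zero_ne_one, if_false, if_true]
      push_cast; ring
    · by_cases hκ1 : κ = 1
      · subst hκ1
        simp only [fin_one_ne_zero, if_false, if_true]
        push_cast; ring
      · simp only [hκ0, hκ1, if_false]
        push_cast; ring
  rw [key]

end PathSums

end

end Summit.QuantumFields.YangMills.BalabanUVNodes.N16SheetDatumPreimage
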